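import Summits.BirchSwinnertonDyer.BirchSwinnertonDyer.Theorems.Rank2ObservatoryCubicFieldR183581
import Summits.BirchSwinnertonDyer.BirchSwinnertonDyer.Theorems.Rank2Observatory2DescLinGens
import HarnessLib

/-!
# BirchSwinnertonDyer — rank ≥ 2 observatory: prime elements of the cubic field of `-52 + 81 * X - 19 * X ^ 2 + X ^ 3` (generator addendum `R183581 C1a`)

HONEST FRAMING: per-curve certified theorems and census instruments; no claim on BSD in rank ≥ 2.

Per-FIELD addendum of the KERNEL-2DESC instrument (design `b2b-bsdr2-cert-3/KERNEL-2DESC.md` §9d) for the cubic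
field `K = ℚ(α)`, `α` a root of `-52 + 81 * X - 19 * X ^ 2 + X ^ 3` (`Δ = 183581`, `𝓞_K` a PID; file `Rank2ObservatoryCubicFieldR183581`):
for 2 elements `e = c₀ + c₁α + c₂α² = lin aeval_α c₀ c₁ c₂` it certifies the norm (`MonicCubic.normForm`,
`norm_lin_eq`) and primality (norm `±p`, or norm `±p^f` with the residue certificate of `lin_prime_of_pow`);
(totally real field: the signs at the three real places are certified inline per curve). These elements generate the primes
dividing `F′(θ)` for the census curves with this `2`-division field, `N < 5·10⁵` (data: kit job `j130842` + second
implementation `percurve/identities3r.py`); the per-curve files `Rank2Observatory<label>TwoDescRankTwo.lean`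
reference them by name (`e_<c₀>_<c₁>_<c₂>_norm|prime`, `m` = minus). Generated by
`percurve/gen_addendum4.py`. Sorry-free; axioms `propext`, `Classical.choice`, `Quot.sound`.
[cite: Marcus2018, Ch. 3, Thm. 22] [cite: Cassels1991LecturesEllipticCurves, §15]
-/

-- single-conjunct summit: `Summit.BirchSwinnertonDyer.BirchSwinnertonDyer.…` repeats the name by design
set_option linter.dupNamespace false

noncomputable section

open scoped NumberField

open Literature.NumberTheory.NumberFields Polynomial NumberField

namespace Summit.BirchSwinnertonDyer.BirchSwinnertonDyer.Rank2Observatory.TwoDescCubic.FieldR183581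

/-- `N(83 - 123 * α + 21 * α ^ 2) = -4` (a prime above `2`, residue degree `2`; first met at `367162a1`). [folklore] -/
theorem e_83_m123_21_norm : Algebra.norm ℚ ((lin aeval_α 83 (-123) 21 : 𝓞 (CubicField (-19) 81 (-52))) : (CubicField (-19) 81 (-52))) = ((-4 : ℤ) : ℚ) :=
  norm_lin_eq irreducible aeval_α finrank_eq 83 (-123) 21 (by norm_num [MonicCubic.normForm])

/-- `83 - 123 * α + 21 * α ^ 2` is prime (norm `±2^2`; it does not vanish at any root of `-52 + 81 * X - 19 * X ^ 2 + X ^ 3 mod 2`).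
[cite: Marcus2018, Ch. 3, Thm. 22] -/
theorem e_83_m123_21_prime : Prime (lin aeval_α 83 (-123) 21 : 𝓞 (CubicField (-19) 81 (-52))) :=
  lin_prime_of_pow irreducible aeval_α finrank_eq 83 (-123) 21 (n := -4)
    (by norm_num [MonicCubic.normForm]) (p := 2) (k := 2) (by norm_num) (Or.inl rfl) (by norm_num)
    (by decide +kernel)

/-- `N(81 - 38 * α + 3 * α ^ 2) = -183581` (a prime above `183581`, residue degree `1`; first met at `367162a1`). [folklore] -/
theorem e_81_m38_3_norm : Algebra.norm ℚ ((lin aeval_α 81 (-38) 3 : 𝓞 (CubicField (-19) 81 (-52))) : (CubicField (-19) 81 (-52))) = ((-183581 : ℤ) : ℚ) :=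
  norm_lin_eq irreducible aeval_α finrank_eq 81 (-38) 3 (by norm_num [MonicCubic.normForm])

/-- `81 - 38 * α + 3 * α ^ 2` is prime (norm `±183581`). [cite: Marcus2018, Ch. 3, Thm. 22] -/
theorem e_81_m38_3_prime : Prime (lin aeval_α 81 (-38) 3 : 𝓞 (CubicField (-19) 81 (-52))) :=
  lin_prime_of_prime irreducible aeval_α finrank_eq 81 (-38) 3 (n := -183581)
    (by norm_num [MonicCubic.normForm]) (by norm_num)

end Summit.BirchSwinnertonDyer.BirchSwinnertonDyer.Rank2Observatory.TwoDescCubic.FieldR183581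

end
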